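import Summits.BirchSwinnertonDyer.BirchSwinnertonDyer.Theorems.Rank2ObservatoryCubicFieldR22044
import Summits.BirchSwinnertonDyer.BirchSwinnertonDyer.Theorems.Rank2Observatory2DescLinGens
import HarnessLib

/-!
# BirchSwinnertonDyer — rank ≥ 2 observatory: prime elements of the cubic field of `-6 + 24 * X - 13 * X ^ 2 + X ^ 3` (generator addendum `R22044 R3a`)

HONEST FRAMING: per-curve certified theorems and census instruments; no claim on BSD in rank ≥ 2.

Per-FIELD addendum of the KERNEL-2DESC instrument (design `b2b-bsdr2-cert-3/KERNEL-2DESC.md` §9d; rank-3 port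
`b2b-bsdr2-cert-2/kernel-2desc3/README.md`) for the cubic
field `K = ℚ(α)`, `α` a root of `-6 + 24 * X - 13 * X ^ 2 + X ^ 3` (`Δ = 22044`, `𝓞_K` a PID; file `Rank2ObservatoryCubicFieldR22044`):
for 1 elements `e = c₀ + c₁α + c₂α² = lin aeval_α c₀ c₁ c₂` it certifies the norm (`MonicCubic.normForm`,
`norm_lin_eq`) and primality (norm `±p`, or norm `±p^f` with the residue certificate of `lin_prime_of_pow`);
(totally real field: the signs at the three real places are certified inline per curve). These elements generate the primes
dividing `F′(θ)` for the RANK-3 census curves with this `2`-division field, `N < 5·10⁵` (data: kit job `j131165` + second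
implementation `scripts/identities_r3r.py`); the per-curve files `Rank2Observatory<label>TwoDescRankThree.lean`
reference them by name (`e_<c₀>_<c₁>_<c₂>_norm|prime`, `m` = minus). Generated by
`scripts/gen_addendum_r3.py` (cert-3 `gen_addendum4.py` v4, rank-3 port). Sorry-free; axioms `propext`, `Classical.choice`, `Quot.sound`.
[cite: Marcus2018, Ch. 3, Thm. 22] [cite: Cassels1991LecturesEllipticCurves, §15]
-/

-- single-conjunct summit: `Summit.BirchSwinnertonDyer.BirchSwinnertonDyer.…` repeats the name by design
set_option linter.dupNamespace false

noncomputable section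

open scoped NumberField

open Literature.NumberTheory.NumberFields Polynomial NumberField

namespace Summit.BirchSwinnertonDyer.BirchSwinnertonDyer.Rank2Observatory.TwoDescCubic.FieldR22044

/-- `N(-113 + 68 * α - 4 * α ^ 2) = -289` (a prime above `17`, residue degree `2`; first met at `187374h1`). [folklore] -/
theorem e_m113_68_m4_norm : Algebra.norm ℚ ((lin aeval_α (-113) 68 (-4) : 𝓞 (CubicField (-13) 24 (-6))) : (CubicField (-13) 24 (-6))) = ((-289 : ℤ) : ℚ) :=
  norm_lin_eq irreducible aeval_α finrank_eq (-113) 68 (-4) (by norm_num [MonicCubic.normForm])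

/-- `-113 + 68 * α - 4 * α ^ 2` is prime (norm `±17^2`; it does not vanish at any root of `-6 + 24 * X - 13 * X ^ 2 + X ^ 3 mod 17`).
[cite: Marcus2018, Ch. 3, Thm. 22] -/
theorem e_m113_68_m4_prime : Prime (lin aeval_α (-113) 68 (-4) : 𝓞 (CubicField (-13) 24 (-6))) :=
  lin_prime_of_pow irreducible aeval_α finrank_eq (-113) 68 (-4) (n := -289)
    (by norm_num [MonicCubic.normForm]) (p := 17) (k := 2) (by norm_num) (Or.inl rfl) (by norm_num)
    (by decide +kernel)

end Summit.BirchSwinnertonDyer.BirchSwinnertonDyer.Rank2Observatory.TwoDescCubic.FieldR22044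

end
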